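import Summits.AtomisticToContinuum.BoseEinsteinCondensation.Theorems.BECThomsonPrincipleGDTransferSeededProjectedDichotomySector

/-!
# Route `BECThomsonPrinciple`, crux `GDTransfer` (stmt-AtomisticToContinuum-9482), line `seeded-continuity`:
# stub `stub_projectedDichotomy`, part A3a — the bound `n̂₀^{-1/2} ≥ N^{-1/2}(1 − Q_∅)` and the cardinality decomposition

Support file of the registered stub `stub_projectedDichotomy` (toolkit for the zero-defect response of the plain
witness pair, part A3b `…Positivity`):
* `⟨h, n̂₀^{-1/2}h⟩ = Σ_{S≠∅}|S|^{-1/2}‖Q_S h‖²` (`integral_conj_mul_rootInv_self`) and hence, for continuous `h` with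
  `Q_∅ h = 0`, `N^{-1/2}‖h‖² ≤ Σ_{S≠∅}|S|^{-1/2}‖Q_S h‖²` (`rootInv_lower`; `|S| ≤ N`, `Σ_S‖Q_S h‖² = ‖h‖²`);
* the CARDINALITY decomposition `g = Σ_{j ≤ N} Π_j g`, `n̂₀^{-1/2}g = Σ_{1 ≤ j ≤ N} j^{-1/2}Π_j g` with
  `Π_j = Σ_{|S| = j}Q_S` (`sum_cardSum_apply`, `rootInv_apply_eq_cardSum`);
* linearity of `B_n = Σ_i e_n(x_i)P_i` over finite sums (`upB_finset_sum`), diagonality of its sesquilinear form on the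
  cardinality decomposition (`integral_conj_sum_upB_mul_sum_upB`, from the cross-cardinality orthogonality of part A2)
  and `B_n Π_0 = 0` (`upB_cardSum_zero`).
All [folklore] (arXiv:1211.2778 §2; LSSY2005 App. A).
-/

noncomputable section

open MeasureTheory Filter
open scoped ENNReal NNReal ComplexConjugate

namespace Summit.AtomisticToContinuum.BoseEinsteinCondensation.Cruxes.GDTransfer.Seeded

namespace Cardinality

open Literature.MathematicalPhysics.QuantumManyBody.BoseGas
open Summit.AtomisticToContinuum.BoseEinsteinCondensation.Theorems.GaussianDominationCan.Negative
open Summit.AtomisticToContinuum.BoseEinsteinCondensation.Cruxes.GDTransfer.DysonDressedWitness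
open ChordVariation (continuous_modeProj dir_const_mul mass_smul)
open Lnss Sector

variable {N m : ℕ} {L : ℝ}

/-! ## The operator bound `n̂₀^{-1/2} ≥ N^{-1/2}(1 − Q_∅)` -/

/-- `⟨h, n̂₀^{-1/2} h⟩ = Σ_{S ≠ ∅} |S|^{-1/2} ‖Q_S h‖²` for continuous `h`. [folklore] -/
theorem integral_conj_mul_rootInv_self (hL : 0 < L) {h : Config (m + 1) → ℂ} (hh : Continuous h) :
    ∫ X in cellN (m + 1) L, conj (h X) * rootInv m L h X =
      ((∑ S ∈ (Finset.univ : Finset (Finset (Fin (m + 1)))).filter (fun S => S.Nonempty),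
        (Real.sqrt (S.card : ℝ))⁻¹ * ∫ X in cellN (m + 1) L, ‖modeProj (m + 1) L S h X‖ ^ 2 : ℝ) : ℂ) := by
  have hQ : ∀ S, Continuous (modeProj (m + 1) L S h) := fun S => continuous_modeProj S hh
  have hint : ∀ S ∈ (Finset.univ : Finset (Finset (Fin (m + 1)))).filter (fun S => S.Nonempty),
      Integrable (fun X => ((Real.sqrt (S.card : ℝ))⁻¹ : ℂ) * (conj (h X) * modeProj (m + 1) L S h X))
        ((volume : Measure (Config (m + 1))).restrict (cellN (m + 1) L)) := fun S _ =>
    integrableOn_cellN (continuous_const.mul ((Complex.continuous_conj.comp hh).mul (hQ S))) L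
  unfold rootInv
  calc ∫ X in cellN (m + 1) L, conj (h X) *
        ∑ S ∈ (Finset.univ : Finset (Finset (Fin (m + 1)))).filter (fun S => S.Nonempty),
          ((Real.sqrt (S.card : ℝ))⁻¹ : ℂ) * modeProj (m + 1) L S h X
      = ∫ X in cellN (m + 1) L,
          ∑ S ∈ (Finset.univ : Finset (Finset (Fin (m + 1)))).filter (fun S => S.Nonempty),
            ((Real.sqrt (S.card : ℝ))⁻¹ : ℂ) * (conj (h X) * modeProj (m + 1) L S h X) := by
        refine integral_congr_ae (Eventually.of_forall fun X => ?_)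
        simp only [Finset.mul_sum]
        exact Finset.sum_congr rfl fun S _ => by ring
    _ = ∑ S ∈ (Finset.univ : Finset (Finset (Fin (m + 1)))).filter (fun S => S.Nonempty),
          ((Real.sqrt (S.card : ℝ))⁻¹ : ℂ) * ∫ X in cellN (m + 1) L, conj (h X) * modeProj (m + 1) L S h X := by
        rw [integral_finsetSum _ hint]
        exact Finset.sum_congr rfl fun S _ => integral_const_mul _ _
    _ = ∑ S ∈ (Finset.univ : Finset (Finset (Fin (m + 1)))).filter (fun S => S.Nonempty),
          ((Real.sqrt (S.card : ℝ))⁻¹ : ℂ) *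
            ((∫ X in cellN (m + 1) L, ‖modeProj (m + 1) L S h X‖ ^ 2 : ℝ) : ℂ) := by
        refine Finset.sum_congr rfl fun S _ => ?_
        congr 1
        calc ∫ X in cellN (m + 1) L, conj (h X) * modeProj (m + 1) L S h X
            = ∫ X in cellN (m + 1) L, conj (h X) * modeProj (m + 1) L S (modeProj (m + 1) L S h) X := by
              rw [modeProj_modeProj hL S S hh, if_pos rfl]
          _ = ∫ X in cellN (m + 1) L, conj (modeProj (m + 1) L S h X) * modeProj (m + 1) L S h X :=
              integral_conj_mul_modeProj S hh (hQ S)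
          _ = _ := integral_conj_mul_self _
    _ = _ := by push_cast; rfl

/-- **`n̂₀^{-1/2} ≥ N^{-1/2}` off the empty sector**: for continuous `h` with `Q_∅ h = 0`,
`N^{-1/2} ∫|h|² ≤ Σ_{S ≠ ∅} |S|^{-1/2} ∫|Q_S h|²` (`|S| ≤ N`, `Σ_S ∫|Q_S h|² = ∫|h|²`). [folklore] -/
theorem rootInv_lower (hL : 0 < L) {h : Config (m + 1) → ℂ} (hh : Continuous h)
    (h0 : modeProj (m + 1) L ∅ h = 0) :
    (Real.sqrt ((m : ℝ) + 1))⁻¹ * ∫ X in cellN (m + 1) L, ‖h X‖ ^ 2 ≤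
      ∑ S ∈ (Finset.univ : Finset (Finset (Fin (m + 1)))).filter (fun S => S.Nonempty),
        (Real.sqrt (S.card : ℝ))⁻¹ * ∫ X in cellN (m + 1) L, ‖modeProj (m + 1) L S h X‖ ^ 2 := by
  have hN : (0 : ℝ) < (m : ℝ) + 1 := by positivity
  rw [← sum_integral_norm_sq_modeProj hL hh, Finset.mul_sum, Finset.sum_filter]
  refine Finset.sum_le_sum fun S _ => ?_
  by_cases hS : S.Nonempty
  · rw [if_pos hS]
    refine mul_le_mul_of_nonneg_right ?_ (integral_nonneg fun X => sq_nonneg _)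
    have hcard : (S.card : ℝ) ≤ (m : ℝ) + 1 := by
      have := S.card_le_univ
      rw [Fintype.card_fin] at this
      exact_mod_cast this
    have hpos : 0 < Real.sqrt (S.card : ℝ) := Real.sqrt_pos.2 (by exact_mod_cast Finset.card_pos.2 hS)
    exact inv_anti₀ hpos (Real.sqrt_le_sqrt hcard)
  · rw [if_neg hS, Finset.not_nonempty_iff_eq_empty.1 hS, h0]
    simp

/-! ## The cardinality decomposition -/

/-- `g = Σ_{j ≤ N} Π_j g` pointwise (`Π_j = Σ_{|S| = j} Q_S`, `Σ_S Q_S = 1`). [folklore] -/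
theorem sum_cardSum_apply (g : Config N → ℂ) (X : Config N) :
    ∑ j ∈ Finset.range (N + 1), ∑ T ∈ (Finset.univ : Finset (Finset (Fin N))).filter (fun T => T.card = j),
        modeProj N L T g X = g X := by
  rw [Finset.sum_fiberwise_of_maps_to (g := Finset.card) (fun T _ => Finset.mem_range.2
    (Nat.lt_succ_of_le (by simpa only [Fintype.card_fin] using T.card_le_univ)))]
  have e := congrFun (sum_modeProj (L := L) g) X
  rwa [Finset.sum_apply] at e

/-- `n̂₀^{-1/2} g = Σ_{1 ≤ j ≤ N} j^{-1/2} Π_j g` pointwise. [folklore] -/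
theorem rootInv_apply_eq_cardSum (g : Config (m + 1) → ℂ) (X : Config (m + 1)) :
    rootInv m L g X = ∑ j ∈ Finset.range (m + 2),
      (if j = 0 then 0 else ((Real.sqrt (j : ℝ))⁻¹ : ℂ)) *
        ∑ T ∈ (Finset.univ : Finset (Finset (Fin (m + 1)))).filter (fun T => T.card = j),
          modeProj (m + 1) L T g X := by
  have hmaps : ∀ T ∈ (Finset.univ : Finset (Finset (Fin (m + 1)))), T.card ∈ Finset.range (m + 2) :=
    fun T _ => Finset.mem_range.2 (Nat.lt_succ_of_le (by simpa only [Fintype.card_fin] using T.card_le_univ))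
  have key : ∀ T : Finset (Fin (m + 1)),
      (if T.Nonempty then ((Real.sqrt (T.card : ℝ))⁻¹ : ℂ) * modeProj (m + 1) L T g X else 0) =
        (if T.card = 0 then 0 else ((Real.sqrt (T.card : ℝ))⁻¹ : ℂ)) * modeProj (m + 1) L T g X := by
    intro T
    by_cases hT : T.Nonempty
    · rw [if_pos hT, if_neg (Finset.card_pos.2 hT).ne']
    · rw [if_neg hT, if_pos (Finset.card_eq_zero.2 (Finset.not_nonempty_iff_eq_empty.1 hT)), zero_mul]
  unfold rootInv
  rw [Finset.sum_filter]
  simp only [key]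
  rw [← Finset.sum_fiberwise_of_maps_to hmaps]
  refine Finset.sum_congr rfl fun j _ => ?_
  rw [Finset.mul_sum]
  refine Finset.sum_congr rfl fun T hT => ?_
  rw [(Finset.mem_filter.1 hT).2]

/-- **`B_n` is linear over finite sums** of continuous functions. [folklore] -/
theorem upB_finset_sum {ι : Type*} (T : Finset ι) (c : ι → ℂ) {f : ι → Config N → ℂ}
    (hf : ∀ t ∈ T, Continuous (f t)) (n : Fin 3 → ℤ) :
    (fun X => ∑ i : Fin N, cellWave L n (X i) * cellAvg N L i (fun Y => ∑ t ∈ T, c t * f t Y) X) =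
      fun X => ∑ t ∈ T, c t * ∑ i : Fin N, cellWave L n (X i) * cellAvg N L i (f t) X := by
  funext X
  simp only [cellAvg_finset_sum T c hf, Finset.mul_sum]
  rw [Finset.sum_comm]
  exact Finset.sum_congr rfl fun t _ => Finset.sum_congr rfl fun i _ => by ring

/-- **The sesquilinear form of `B_n` on the cardinality decomposition is diagonal**: with `A_j = B_n Π_j g`,
`∫ conj(Σ_{j'} c'_{j'} A_{j'}) (Σ_j c_j A_j) = Σ_j conj(c'_j) c_j ∫|A_j|²` (cross-cardinality orthogonality, part A2).
[folklore] -/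
theorem integral_conj_sum_upB_mul_sum_upB (hL : 0 < L) {n : Fin 3 → ℤ} (hn : n ≠ 0) (c c' : ℕ → ℂ)
    {g : Config (m + 1) → ℂ} (hg : Continuous g) :
    ∫ X in cellN (m + 1) L,
        conj (∑ j ∈ Finset.range (m + 2), c' j * ∑ i : Fin (m + 1), cellWave L n (X i) *
          cellAvg (m + 1) L i (fun Y => ∑ T ∈ (Finset.univ : Finset (Finset (Fin (m + 1)))).filter
            (fun T => T.card = j), modeProj (m + 1) L T g Y) X) *
        (∑ j ∈ Finset.range (m + 2), c j * ∑ i : Fin (m + 1), cellWave L n (X i) *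
          cellAvg (m + 1) L i (fun Y => ∑ T ∈ (Finset.univ : Finset (Finset (Fin (m + 1)))).filter
            (fun T => T.card = j), modeProj (m + 1) L T g Y) X) =
      ∑ j ∈ Finset.range (m + 2), conj (c' j) * c j *
        ((∫ X in cellN (m + 1) L, ‖∑ i : Fin (m + 1), cellWave L n (X i) *
          cellAvg (m + 1) L i (fun Y => ∑ T ∈ (Finset.univ : Finset (Finset (Fin (m + 1)))).filter
            (fun T => T.card = j), modeProj (m + 1) L T g Y) X‖ ^ 2 : ℝ) : ℂ) := by
  -- abbreviations
  set A : ℕ → Config (m + 1) → ℂ := fun j X => ∑ i : Fin (m + 1), cellWave L n (X i) *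
    cellAvg (m + 1) L i (fun Y => ∑ T ∈ (Finset.univ : Finset (Finset (Fin (m + 1)))).filter
      (fun T => T.card = j), modeProj (m + 1) L T g Y) X with hA
  have hPic : ∀ j, Continuous (fun Y => ∑ T ∈ (Finset.univ : Finset (Finset (Fin (m + 1)))).filter
      (fun T => T.card = j), modeProj (m + 1) L T g Y) := fun j =>
    continuous_finsetSum _ fun T _ => continuous_modeProj T hg
  have hAc : ∀ j, Continuous (A j) := fun j =>
    continuous_finsetSum _ fun i _ =>
      ((continuous_cellWave L n).comp (continuous_apply i)).mul (continuous_cellAvg i (hPic j))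
  -- orthogonality across cardinalities
  have horth : ∀ j j', j ≠ j' → ∫ X in cellN (m + 1) L, conj (A j' X) * A j X = 0 := by
    intro j j' hjj
    refine integral_conj_mul_eq_zero_of_disjoint_support (hAc j') (hAc j) fun S => ?_
    by_cases hS : S.card + 1 = j'
    · right
      exact modeProj_upB_cardSum hL hn j (by rw [hS]; exact Ne.symm hjj) hg
    · left
      exact modeProj_upB_cardSum hL hn j' hS hg
  have hint : ∀ j' j, Integrable (fun X => conj (c' j') * c j * (conj (A j' X) * A j X))
      ((volume : Measure (Config (m + 1))).restrict (cellN (m + 1) L)) := fun j' j =>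
    integrableOn_cellN (continuous_const.mul ((Complex.continuous_conj.comp (hAc j')).mul (hAc j))) L
  show ∫ X in cellN (m + 1) L, conj (∑ j ∈ Finset.range (m + 2), c' j * A j X) *
      (∑ j ∈ Finset.range (m + 2), c j * A j X) =
    ∑ j ∈ Finset.range (m + 2), conj (c' j) * c j * ((∫ X in cellN (m + 1) L, ‖A j X‖ ^ 2 : ℝ) : ℂ)
  calc ∫ X in cellN (m + 1) L, conj (∑ j ∈ Finset.range (m + 2), c' j * A j X) *
        (∑ j ∈ Finset.range (m + 2), c j * A j X)
      = ∫ X in cellN (m + 1) L, ∑ j' ∈ Finset.range (m + 2), ∑ j ∈ Finset.range (m + 2),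
          conj (c' j') * c j * (conj (A j' X) * A j X) := by
        refine integral_congr_ae (Eventually.of_forall fun X => ?_)
        dsimp only
        rw [map_sum, Finset.sum_mul_sum]
        refine Finset.sum_congr rfl fun j' _ => Finset.sum_congr rfl fun j _ => ?_
        rw [map_mul]
        ring
    _ = ∑ j' ∈ Finset.range (m + 2), ∑ j ∈ Finset.range (m + 2),
          ∫ X in cellN (m + 1) L, conj (c' j') * c j * (conj (A j' X) * A j X) := by
        rw [integral_finsetSum _ fun j' _ => integrable_finsetSum _ fun j _ => hint j' j]
        exact Finset.sum_congr rfl fun j' _ => integral_finsetSum _ fun j _ => hint j' j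
    _ = ∑ j ∈ Finset.range (m + 2), conj (c' j) * c j * ((∫ X in cellN (m + 1) L, ‖A j X‖ ^ 2 : ℝ) : ℂ) := by
        refine Finset.sum_congr rfl fun j' hj' => ?_
        rw [Finset.sum_eq_single_of_mem j' hj' fun j _ hjj => ?_]
        · rw [integral_const_mul, integral_conj_mul_self]
        · rw [integral_const_mul, horth j j' hjj, mul_zero]

/-- `B_n Π_0 g = 0` (there is no sector below the empty one). [folklore] -/
theorem upB_cardSum_zero (hL : 0 < L) {n : Fin 3 → ℤ} (hn : n ≠ 0) {g : Config N → ℂ} (hg : Continuous g) :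
    (fun X => ∑ i : Fin N, cellWave L n (X i) *
        cellAvg N L i (fun Y => ∑ T ∈ (Finset.univ : Finset (Finset (Fin N))).filter (fun T => T.card = 0),
          modeProj N L T g Y) X) = 0 := by
  have h := sum_modeProj (L := L) (fun X => ∑ i : Fin N, cellWave L n (X i) *
    cellAvg N L i (fun Y => ∑ T ∈ (Finset.univ : Finset (Finset (Fin N))).filter (fun T => T.card = 0),
      modeProj N L T g Y) X)
  rw [← h]
  exact Finset.sum_eq_zero fun S _ => modeProj_upB_cardSum hL hn 0 (Nat.succ_ne_zero _) hg

end Cardinality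

/-- **Part A3a of `stub_projectedDichotomy` (registered helper statement)**: the operator bound
`n̂₀^{-1/2} ≥ N^{-1/2}` off the empty sector — for continuous `h` with `Q_∅ h = 0`,
`N^{-1/2} ∫|h|² ≤ Σ_{S ≠ ∅} |S|^{-1/2} ∫|Q_S h|²`. [folklore] -/
theorem cardinality_rootInv_lower :
    ∀ (m : ℕ) (L : ℝ), 0 < L → ∀ (h : Literature.MathematicalPhysics.QuantumManyBody.BoseGas.Config (m + 1) → ℂ),
      Continuous h →
      Summit.AtomisticToContinuum.BoseEinsteinCondensation.Theorems.GaussianDominationCan.Negative.modeProj (m + 1) L ∅ h =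
          0 →
        (Real.sqrt ((m : ℝ) + 1))⁻¹ *
            ∫ X in Literature.MathematicalPhysics.QuantumManyBody.BoseGas.cellN (m + 1) L, ‖h X‖ ^ 2 ≤
          ∑ S ∈ (Finset.univ : Finset (Finset (Fin (m + 1)))).filter (fun S => S.Nonempty),
            (Real.sqrt (S.card : ℝ))⁻¹ *
              ∫ X in Literature.MathematicalPhysics.QuantumManyBody.BoseGas.cellN (m + 1) L,
                ‖Summit.AtomisticToContinuum.BoseEinsteinCondensation.Theorems.GaussianDominationCan.Negative.modeProj
                    (m + 1) L S h X‖ ^ 2 :=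
  fun _ _ hL _ hh h0 => Cardinality.rootInv_lower hL hh h0

end Summit.AtomisticToContinuum.BoseEinsteinCondensation.Cruxes.GDTransfer.Seeded

end
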